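import Summits.BirchSwinnertonDyer.BirchSwinnertonDyer.Theorems.ManinLocalTwoThreeKatoShiftThreeDvdShiftClass
import Summits.BirchSwinnertonDyer.Rank1Residual.ManinAdditive.KatoShiftThreeLawsEdges
import Literature.NumberTheory.EllipticCurves.RootNumberAtkinLehnerSemistableProofs

/-!
# Route `ManinLocalTwoThree`, crux C3 `ManinPrimeToThreeAtNine` (stmt-BirchSwinnertonDyer-22968), line
# `kato-shift-three`: the LEVER kernel-checked end to end — `KatoShiftTwistManinThree` (E-es-18) and the crux
# follow from the `p = 3` Kato fact, the shift-generation law E-es-19 and the reducible residual, with NO other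
# input (line prover p1; helper)

This file removes the last auxiliary binder of `…KatoShiftThreeDvdShiftClass` (`a_q ∈ {1, −1}` at the primes
`q ∥ N` of the LEVEL) — over the tree `a_q ∈ {1, −1, 0}` at every prime `q` dividing the level
(`IsNewformOf.dvd_level_iff_dvd_conductorNorm` (Diamond–Shurman (8.44)), bad reduction at the place over `q`
(`not_hasGoodReductionAt_ringOfIntegers_of_dvd_conductorNorm`), local factors `1 ∓ T` / `1`
(`LFunction_apply_primesEquiv_of_…`)), and the symmetrised Euler factor is a `3`-unit in all three cases —
and plugs the resulting shift step into the tree's composition `katoShiftTwistManinThree_of_shiftStep`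
(`KatoShiftThreeLawsEdges`, typer g3 / es g6):

* `lFunction_eq_one_or_neg_one_or_zero_of_dvd_level` — `a_q ∈ {1, −1, 0}` for `q ∣ N` (level of a datum);
* `exists_symmEuler_prod_mul_eq_three'` — the Euler `3`-unit with `a_q = 0` allowed (factor `q²`);
* `shiftStep_of_katoFact` — VERBATIM the hypothesis `hE` of `katoShiftTwistManinThree_of_shiftStep`
  (= the conclusion of the line's registered stub `stub_three_dvd_shiftClass`, in the vocabulary
  `AdmissiblePrime` / `shiftClass` of `KatoShiftThreeLawsEdges`), from the fact ALONE;
* `katoShiftTwistManinThree_of_katoFact_of_generation` — **E-es-18 ⟸ F-es-18 ∧ E-es-19**;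
* `maninPrimeToThreeAtNine_of_katoFact_of_generation_of_reducible` — **the crux C3 BY NAME ⟸ F-es-18 ∧
  E-es-19 ∧ `ManinPrimeToThreeOfReducible`** (conditional; the three inputs are exactly the tree's named
  fact `kato_neron_isIntegral_twistedSymbolSum_of_additive_three_polar`, the `@[conjecture]` leaf
  `ShiftClassGenerationThree`, and the `@[conjecture]` residual leaf).

Nothing about BSD is proved here; Manin's conjecture at `3` is NOT proved here (two of the three inputs are
open).
-/

set_option autoImplicit false
set_option linter.dupNamespace false

noncomputable section

open scoped Classical MatrixGroups ModularForm

open CongruenceSubgroup Complex IsDedekindDomain Rat.HeightOneSpectrum NumberField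
  Literature.NumberTheory.EllipticCurves Literature.NumberTheory.EllipticCurves.ModularForms
  Summit.BirchSwinnertonDyer.BirchSwinnertonDyer.Theorems.ManinFrameResidueProperRTameTwist
  Summit.BirchSwinnertonDyer.Rank1Residual.ManinAdditive

namespace Summit.BirchSwinnertonDyer.BirchSwinnertonDyer.Theorems.ManinLocalTwoThree

section Lever

variable {W : WeierstrassCurve ℚ} [W.IsElliptic] {N : ℕ} [NeZero N]

/-- **`a_q ∈ {1, −1, 0}` at a prime `q` dividing the level of a newform of `W`** (`q ∣ N ⟺ q ∣ N_W`, so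
`W` has bad reduction at the place over `q`; the local factor is `1 − T`, `1 + T` or `1`).
[cite: SilvermanAEC2009, §C.16 (definition of L_v(T)), PDF p. 390] [cite: DiamondShurman2005, (8.44)] -/
theorem lFunction_eq_one_or_neg_one_or_zero_of_dvd_level {f : CuspForm (Gamma0 N) 2}
    (hf : IsNewformOf W f) {q : ℕ} (hq : q.Prime) (hqN : q ∣ N) :
    W.LFunction q = 1 ∨ W.LFunction q = -1 ∨ W.LFunction q = 0 := by
  have hqc : q ∣ W.conductorNorm ℤ := (hf.dvd_level_iff_dvd_conductorNorm hq).mp hqN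
  set v : HeightOneSpectrum (𝓞 ℚ) := (primesEquiv (R := 𝓞 ℚ)).symm ⟨q, hq⟩ with hv
  have hbad : ¬ W.HasGoodReductionAt v :=
    W.not_hasGoodReductionAt_ringOfIntegers_of_dvd_conductorNorm ⟨q, hq⟩ hqc
  have hpv : ((primesEquiv v : Nat.Primes) : ℕ) = q := by
    rw [hv, Equiv.apply_symm_apply]
  rcases W.hasGoodReductionAt_or_hasMultiplicativeReductionAt_or_hasAdditiveReductionAt v with
    hg | hm | ha
  · exact absurd hg hbad
  · by_cases hs : W.HasSplitMultiplicativeReductionAt v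
    · left
      rw [← hpv]; exact W.LFunction_apply_primesEquiv_of_hasSplitMultiplicativeReductionAt hs
    · right; left
      rw [← hpv]
      exact W.LFunction_apply_primesEquiv_of_hasMultiplicativeReductionAt_of_not_split hm hs
  · right; right
    rw [← hpv]; exact W.LFunction_apply_primesEquiv_of_hasAdditiveReductionAt ha

omit [W.IsElliptic] [NeZero N] in
/-- **The symmetrised `N`-imprimitivity factor is a `3`-unit, `a_q ∈ {1, −1, 0}` allowed** (the case
`a_q = 0` contributes `q²`, a `3`-unit for `q ≠ 3`). [folklore] -/
theorem exists_symmEuler_prod_mul_eq_three' {ℓ : ℕ} [Fact ℓ.Prime] (h12 : ℓ % 12 = 11) (a : ℕ → ℤ)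
    (ha : ∀ q ∈ N.primeFactors, ¬ q ^ 2 ∣ N → a q = 1 ∨ a q = -1 ∨ a q = 0)
    (h3 : ∀ q ∈ N.primeFactors, ¬ q ^ 2 ∣ N → q ≠ 3)
    (hℓN : ¬ ℓ ∣ N) {χ : DirichletCharacter ℂ ℓ} (hχ : χ.Odd)
    (hL : ∀ q ∈ N.primeFactors, ¬ q ^ 2 ∣ N →
      ((3 : ℤ) ∣ (q : ℤ) * a q - 1 → ¬ IsSquare ((q : ℕ) : ZMod ℓ)) ∧
        (¬ (3 : ℤ) ∣ (q : ℤ) * a q - 1 → IsSquare ((q : ℕ) : ZMod ℓ))) :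
    ∃ (w : ℂ) (t : ℤ), IsIntegral ℤ w ∧
      (∏ q ∈ N.primeFactors with ¬ q ^ 2 ∣ N,
          (((q : ℂ) - (a q : ℂ) * χ (q : ZMod ℓ)) * ((q : ℂ) - (a q : ℂ) * (χ (q : ZMod ℓ))⁻¹))) *
        w = t ∧ ¬ ((3 : ℕ) : ℤ) ∣ t := by
  refine exists_prod_mul_eq Nat.prime_three _ _ fun q hq ↦ ?_
  obtain ⟨hqN, hq2⟩ := Finset.mem_filter.mp hq
  have hqp : q.Prime := Nat.prime_of_mem_primeFactors hqN
  have hqℓ : q ≠ ℓ := by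
    rintro rfl
    exact hℓN (Nat.dvd_of_mem_primeFactors hqN)
  rcases ha q hqN hq2 with h1 | h1 | h0
  · exact exists_symmEulerFactor_mul_eq_three h12 hqp (h3 q hqN hq2) hqℓ (Or.inl h1) hχ (hL q hqN hq2)
  · exact exists_symmEulerFactor_mul_eq_three h12 hqp (h3 q hqN hq2) hqℓ (Or.inr h1) hχ (hL q hqN hq2)
  · refine ⟨1, (q : ℤ) ^ 2, isIntegral_one, ?_, ?_⟩
    · rw [h0]; push_cast; ring
    · intro h
      have h' : (3 : ℤ) ∣ (q : ℤ) := Int.Prime.dvd_pow' Nat.prime_three (by exact_mod_cast h)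
      exact h3 q hqN hq2 ((Nat.prime_dvd_prime_iff_eq Nat.prime_three hqp).mp (by exact_mod_cast h')).symm

end Lever

section Assembly

variable {W : WeierstrassCurve ℚ} [W.IsElliptic] [W.IsGloballyMinimal] {N : ℕ} [NeZero N]

/-- **One odd character with `χ(3) ≠ 1`: `(Σ_a χ(a) y(a))/3` is `3`-integral** (no `a_q` binder: `a_q ∈ {1,−1,0}` is read off the level), GRANTED the `p = 3` Kato
fact, at a lattice-optimal datum of a curve additive at `3` with `W[3]` irreducible and `3 ∣ c`, for an
admissible `ℓ` (prime, `ℓ ∤ N`, `ℓ ≡ 11 (mod 12)`, Legendre conditions at the `q ∥ N` with `a_q = ±1`).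
Chain: the fact gives `s·ϖ·r ∈ ℤ̄` (`3 ∤ s`) with `ϖ = m₀/|c|`, `m₀ ∣ 2`, and
`E(χ)·Σ_a χ(a){∞,a/ℓ} = r·Ω⁻_f·i`; by `Σ_a χ(a){∞,a/ℓ} = i(Ω⁻_f/2)·A` this reads
`s·m₀·E(χ)·A/(2|c|) ∈ ℤ̄`; with `|c| = 3|c'|`, `s m₀ · E(χ)·(A/3) ∈ ℤ̄`, and `E(χ)` is a `3`-unit.
[cite: Kato2004Asterisque, Thm. 9.7 (p. 189)] [cite: KostersPannekoek2017, Thm. 1 (ii)] -/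
theorem pint_charSum_div_three' (hK : kato_neron_isIntegral_twistedSymbolSum_of_additive_three_polar)
    (D : ModularParametrizationData W N)
    (hopt : ∀ z ∈ D.L.lattice, ∃ w ∈ periodLattice D.f, z = D.c * w)
    (hadd : ¬ W.HasGoodReductionAtPrime 3 ∧ ¬ W.HasMultiplicativeReductionAtPrime 3)
    (hirr : W.HasIrreducibleModPGaloisRep 3) (h3c : (3 : ℤ) ∣ D.c) (h9 : 3 ^ 2 ∣ N)
        {ℓ : ℕ} (hℓ : ℓ.Prime) (hℓN : ¬ ℓ ∣ N) (h12 : ℓ % 12 = 11)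
    (hL : ∀ q ∈ N.primeFactors, ¬ q ^ 2 ∣ N →
      jacobiSym (q : ℤ) ℓ = (if ((q : ℤ) * W.LFunction q) % 3 = 1 then -1 else 1))
    {y : ZMod ℓ → ℤ}
    (hy : ∀ x : ZMod ℓ, (modularSymbol D.f (((x.val : ℕ) : ℚ) / ℓ) - modularSymbol D.f 0).im =
      y x * (minusPeriod D.f / 2))
    (χ : DirichletCharacter ℂ ℓ) (hχ : χ.Odd) (hχ3 : χ (3 : ZMod ℓ) ≠ 1) :
    haveI : NeZero ℓ := ⟨hℓ.ne_zero⟩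
    ∃ s : ℕ, ¬ 3 ∣ s ∧ IsIntegral ℤ ((s : ℂ) * ((∑ a : ZMod ℓ, χ a * (y a : ℂ)) / (3 : ℕ))) := by
  haveI : NeZero ℓ := ⟨hℓ.ne_zero⟩
  haveI : Fact ℓ.Prime := ⟨hℓ⟩
  obtain ⟨-, -, h3ℓ1, -, hℓ3, -⟩ := mod_twelve_facts (ℓ := ℓ) h12
  have hreal : ∀ n, (cuspCoeff D.f n).im = 0 :=
    cuspCoeff_im_eq_zero_of_coeffField_eq_bot D.isNewformOf.coeffField_eq_bot
  have hΩf : 0 < minusPeriod D.f :=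
    IsNewform0.minusPeriod_pos_holds D.isNewformOf.1 D.isNewformOf.coeffField_eq_bot
  have hΩ : 0 < W.imaginaryPeriodRat := W.imaginaryPeriodRat_pos
  have hc0 : D.c ≠ 0 := D.maninConstant_ne_zero_holds
  -- the period scalar `ϖ = m₀/|c|`
  obtain ⟨mm, hmm2, hmm⟩ := SkinnerUrban2014.exists_dvd_two_mul_imaginaryPeriodRat_eq_of_latticeEq D hopt
  set cabs : ℤ := |D.c| with hcabs
  have hcabs0 : cabs ≠ 0 := abs_ne_zero.mpr hc0
  set ϖ : ℚ := (mm : ℚ) / (cabs : ℚ) with hϖdef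
  have habs0 : |(D.c : ℝ)| ≠ 0 := abs_ne_zero.mpr (by exact_mod_cast hc0)
  have hcabsR : ((cabs : ℤ) : ℝ) = |(D.c : ℝ)| := by rw [hcabs, Int.cast_abs]
  have hϖ : (ϖ : ℝ) * W.imaginaryPeriodRat = minusPeriod D.f := by
    rw [hϖdef]; push_cast
    rw [hcabsR, div_mul_eq_mul_div, hmm]
    field_simp
  -- the symmetrised Euler factor and the twisted value
  set A : ℂ := ∑ a : ZMod ℓ, χ a * (y a : ℂ) with hAdef
  set E : ℂ := ∏ q ∈ N.primeFactors with ¬ q ^ 2 ∣ N,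
      (((q : ℂ) - (W.LFunction q : ℂ) * χ (q : ZMod ℓ)) *
        ((q : ℂ) - (W.LFunction q : ℂ) * (χ (q : ZMod ℓ))⁻¹)) with hEdef
  set T : ℂ := twistedSymbolSum D.f χ with hTdef
  have hT : T = I * (((minusPeriod D.f / 2 : ℝ) : ℂ) * A) := by
    have hpt : ∀ x : ZMod ℓ, χ x *
        (((modularSymbol D.f (((x.val : ℕ) : ℚ) / ℓ) - modularSymbol D.f 0).im : ℝ) : ℂ) =
        ((minusPeriod D.f / 2 : ℝ) : ℂ) * (χ x * (y x : ℂ)) := by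
      intro x; rw [hy x]; push_cast; ring
    rw [hTdef, twistedSymbolSum_eq_I_mul_sum D.f hℓ.ne_zero hreal χ hχ,
      Finset.sum_congr rfl (fun x _ ↦ hpt x), ← Finset.mul_sum]
  set r : ℂ := E * T / (((minusPeriod D.f : ℝ) : ℂ) * I) with hrdef
  have hden : ((minusPeriod D.f : ℝ) : ℂ) * I ≠ 0 :=
    mul_ne_zero (by exact_mod_cast hΩf.ne') I_ne_zero
  have hval : E * T = r * (minusPeriod D.f : ℂ) * Complex.I := by
    rw [hrdef, mul_assoc, div_mul_cancel₀ _ hden]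
  -- the fact
  have hm : ℓ.Coprime (3 * N) := Nat.Coprime.mul_right
    ((Nat.coprime_primes hℓ Nat.prime_three).mpr hℓ3) ((hℓ.coprime_iff_not_dvd).mpr hℓN)
  obtain ⟨s, hs, hint⟩ := (hK W D.f D.isNewformOf hadd.1 hadd.2 hirr ℓ hm χ (isPrimitive_of_odd hχ)
    (ne_one_of_odd hχ) (not_three_dvd_orderOf h12 χ) hχ3 (apply_three_ne_neg_one h12 χ) ϖ r).2
    hχ hϖ hval
  -- `ϖ r = (m₀/(2|c|)) · E · A`
  have hcabsC : ((cabs : ℤ) : ℂ) ≠ 0 := by exact_mod_cast hcabs0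
  have hϖC : (ϖ : ℂ) = (mm : ℂ) / ((cabs : ℤ) : ℂ) := by rw [hϖdef]; push_cast; rfl
  have hϖr : (ϖ : ℂ) * r = ((mm : ℂ) / (2 * ((cabs : ℤ) : ℂ))) * (E * A) := by
    rw [hrdef, hT, hϖC]
    have hΩ0 : ((minusPeriod D.f : ℝ) : ℂ) ≠ 0 := by exact_mod_cast hΩf.ne'
    have h2 : ((minusPeriod D.f / 2 : ℝ) : ℂ) = ((minusPeriod D.f : ℝ) : ℂ) / 2 := by push_cast; rfl
    rw [h2]
    field_simp
  -- `|c| = 3 |c'|`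
  obtain ⟨c', hc'⟩ := h3c
  have habs : cabs = 3 * |c'| := by
    rw [hcabs, hc', abs_mul]; norm_num
  have hc'0 : c' ≠ 0 := by rintro rfl; exact hc0 (by rw [hc', mul_zero])
  -- `s m₀ · E · (A/3)` is integral: multiply `s ϖ r` by `2|c'| ∈ ℤ`
  have hkey : (((2 * |c'| : ℤ)) : ℂ) * ((s : ℂ) * (ϖ : ℂ) * r) =
      ((s * mm : ℕ) : ℂ) * (E * (A / (3 : ℕ))) := by
    rw [mul_assoc (s : ℂ), hϖr, habs]
    have habs' : ((|c'| : ℤ) : ℂ) ≠ 0 := by exact_mod_cast (abs_ne_zero.mpr hc'0)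
    push_cast
    field_simp
  have hint2 : IsIntegral ℤ (((s * mm : ℕ) : ℂ) * (E * (A / (3 : ℕ)))) := by
    rw [← hkey]
    exact (isIntegral_algebraMap (R := ℤ) (x := (2 * |c'| : ℤ))).mul (by simpa [mul_assoc] using hint)
  have hsmm : ¬ 3 ∣ s * mm := by
    intro h
    rcases (Nat.Prime.dvd_mul Nat.prime_three).mp h with h1 | h2
    · exact hs h1
    · have : mm ≤ 2 := Nat.le_of_dvd two_pos hmm2
      interval_cases mm <;> omega
  have hpintEA : ∃ s : ℕ, ¬ 3 ∣ s ∧ IsIntegral ℤ ((s : ℂ) * (E * (A / (3 : ℕ)))) := ⟨s * mm, hsmm, hint2⟩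
  -- cancel the `3`-unit `E`
  have hℓN' : ¬ ℓ ∣ N := hℓN
  have h3q : ∀ q ∈ N.primeFactors, ¬ q ^ 2 ∣ N → q ≠ 3 := by
    rintro q hq hq2 rfl; exact hq2 h9
  have hLsq : ∀ q ∈ N.primeFactors, ¬ q ^ 2 ∣ N →
      ((3 : ℤ) ∣ (q : ℤ) * W.LFunction q - 1 → ¬ IsSquare ((q : ℕ) : ZMod ℓ)) ∧
        (¬ (3 : ℤ) ∣ (q : ℤ) * W.LFunction q - 1 → IsSquare ((q : ℕ) : ZMod ℓ)) := by
    intro q hq hq2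
    have hqp : q.Prime := Nat.prime_of_mem_primeFactors hq
    have hqℓ : q ≠ ℓ := by rintro rfl; exact hℓN (Nat.dvd_of_mem_primeFactors hq)
    exact legendre_condition_of_jacobiSym hℓ hqp hqℓ _ (hL q hq hq2)
  have ha : ∀ q ∈ N.primeFactors, ¬ q ^ 2 ∣ N →
      W.LFunction q = 1 ∨ W.LFunction q = -1 ∨ W.LFunction q = 0 := fun q hq _ ↦
    lFunction_eq_one_or_neg_one_or_zero_of_dvd_level D.isNewformOf (Nat.prime_of_mem_primeFactors hq)
      (Nat.dvd_of_mem_primeFactors hq)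
  obtain ⟨w, t, hw, hEw, ht⟩ := exists_symmEuler_prod_mul_eq_three' (ℓ := ℓ) h12 (N := N)
    (fun q ↦ W.LFunction q) ha h3q hℓN' hχ hLsq
  have ht' : ¬ ((3 : ℕ) : ℤ) ∣ t := ht
  exact pint_of_pint_mul_of_mul_eq Nat.prime_three hw hEw ht' hpintEA

/-- **The shift congruence in lattice coordinates** (`stub_three_dvd_shiftClass`, coordinates form):
under the hypotheses of `pint_charSum_div_three` (for all odd `χ` with `χ(3) ≠ 1` at once) the odd
lattice coordinate `y` satisfies `3 ∣ y(3x) − y(x)` for every unit `x` mod `ℓ` — by the hole orthogonality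
(`dvd_sub_of_hole` at `u = 3`, `p = 3`: `3 ∤ ℓ − 1`). [cite: Kato2004Asterisque, Thm. 9.7 (p. 189)] -/
theorem three_dvd_latticeCoord_shift'
    (hK : kato_neron_isIntegral_twistedSymbolSum_of_additive_three_polar)
    (D : ModularParametrizationData W N)
    (hopt : ∀ z ∈ D.L.lattice, ∃ w ∈ periodLattice D.f, z = D.c * w)
    (hadd : ¬ W.HasGoodReductionAtPrime 3 ∧ ¬ W.HasMultiplicativeReductionAtPrime 3)
    (hirr : W.HasIrreducibleModPGaloisRep 3) (h3c : (3 : ℤ) ∣ D.c) (h9 : 3 ^ 2 ∣ N)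
    {ℓ : ℕ} (hℓ : ℓ.Prime) (hℓN : ¬ ℓ ∣ N) (h12 : ℓ % 12 = 11)
    (hL : ∀ q ∈ N.primeFactors, ¬ q ^ 2 ∣ N →
      jacobiSym (q : ℤ) ℓ = (if ((q : ℤ) * W.LFunction q) % 3 = 1 then -1 else 1))
    {y : ZMod ℓ → ℤ}
    (hy : ∀ x : ZMod ℓ, (modularSymbol D.f (((x.val : ℕ) : ℚ) / ℓ) - modularSymbol D.f 0).im =
      y x * (minusPeriod D.f / 2))
    (hodd : ∀ x : ZMod ℓ, y (-x) = -y x) (β : (ZMod ℓ)ˣ) :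
    (3 : ℤ) ∣ y (3 * (β : ZMod ℓ)) - y β := by
  haveI : NeZero ℓ := ⟨hℓ.ne_zero⟩
  haveI : Fact ℓ.Prime := ⟨hℓ⟩
  obtain ⟨-, -, h3ℓ1, -, hℓ3, -⟩ := mod_twelve_facts (ℓ := ℓ) h12
  -- the unit `3` of `ℤ/ℓ`
  have hcop : Nat.Coprime 3 ℓ := (Nat.coprime_primes Nat.prime_three hℓ).mpr hℓ3.symm
  set u : (ZMod ℓ)ˣ := ZMod.unitOfCoprime 3 hcop with hu
  have hu3 : (u : ZMod ℓ) = 3 := by rw [hu, ZMod.coe_unitOfCoprime]; norm_num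
  have hφ : ¬ 3 ∣ ℓ.totient := by rw [Nat.totient_prime hℓ]; exact h3ℓ1
  have hf : ¬ 3 ∣ orderOf u := by
    intro h
    apply hφ
    rw [← ZMod.card_units_eq_totient ℓ]
    exact h.trans (orderOf_dvd_card)
  have hA : ∀ χ : DirichletCharacter ℂ ℓ, χ.Odd → χ (u : ZMod ℓ) ≠ 1 →
      ∃ s : ℕ, ¬ 3 ∣ s ∧ IsIntegral ℤ ((s : ℂ) * ((∑ a : ZMod ℓ, χ a * (y a : ℂ)) / (3 : ℕ))) := by
    intro χ hχ hχu
    rw [hu3] at hχu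
    exact pint_charSum_div_three' hK D hopt hadd hirr h3c h9 hℓ hℓN h12 hL hy χ hχ hχu
  have h := dvd_sub_of_hole (p := 3) Nat.prime_three y hodd u β hφ hf hA
  rwa [Units.val_mul, hu3] at h

/-- **`stub_three_dvd_shiftClass` of the line `kato-shift-three`, conclusion form** (admissibility and
the shift class spelled out; `IsLatticeOptimal` = the lattice clause): GRANTED the `p = 3` Kato fact, at a
lattice-optimal `X₀(N)`-datum `D` of a globally minimal `W` with `9 ∣ N`, `W` additive at `3`, `W[3]`
irreducible and `3 ∣ c`, for every admissible prime `ℓ` (`ℓ ∤ N`, `ℓ ≡ 11 (mod 12)`, `(q/ℓ) = ε_q` at the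
`q ∥ N`, where `a_q = ±1`) and every `0 < a < ℓ`:
`Im(({∞,3a/ℓ}_f − {∞,0}_f) − ({∞,a/ℓ}_f − {∞,0}_f)) = 3n·(Ω⁻_f/2)` for an integer `n`.
[cite: Kato2004Asterisque, Thm. 9.7 (p. 189)] [cite: KostersPannekoek2017, Thm. 1 (ii)]
[cite: MazurTateTeitelbaum1986, §I.8] -/
theorem exists_int_im_shiftClass_eq_three_mul'
    (hK : kato_neron_isIntegral_twistedSymbolSum_of_additive_three_polar)
    (D : ModularParametrizationData W N)
    (hopt : ∀ z ∈ D.L.lattice, ∃ w ∈ periodLattice D.f, z = D.c * w) (h9 : 3 ^ 2 ∣ N)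
    (hadd : ¬ W.HasGoodReductionAtPrime 3 ∧ ¬ W.HasMultiplicativeReductionAtPrime 3)
    (hirr : W.HasIrreducibleModPGaloisRep 3) (h3c : (3 : ℤ) ∣ D.c)
    {ℓ : ℕ} (hℓ : ℓ.Prime) (hℓN : ¬ ℓ ∣ N) (h12 : ℓ % 12 = 11)
    (hL : ∀ q ∈ N.primeFactors, ¬ q ^ 2 ∣ N →
      jacobiSym (q : ℤ) ℓ = (if ((q : ℤ) * W.LFunction q) % 3 = 1 then -1 else 1))
    (a : ℕ) (ha0 : 0 < a) (haℓ : a < ℓ) :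
    ∃ n : ℤ, ((modularSymbol D.f (((3 * a : ℕ) : ℚ) / ℓ) - modularSymbol D.f 0) -
        (modularSymbol D.f ((a : ℚ) / ℓ) - modularSymbol D.f 0)).im = 3 * n * (minusPeriod D.f / 2) := by
  haveI : NeZero ℓ := ⟨hℓ.ne_zero⟩
  haveI : Fact ℓ.Prime := ⟨hℓ⟩
  obtain ⟨y, hy, hodd⟩ := exists_latticeCoord D hℓ hℓN
  -- the unit `a` of `ℤ/ℓ`
  have hcop : Nat.Coprime a ℓ :=
    Nat.Coprime.symm ((Nat.Prime.coprime_iff_not_dvd hℓ).mpr (Nat.not_dvd_of_pos_of_lt ha0 haℓ))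
  set β : (ZMod ℓ)ˣ := ZMod.unitOfCoprime a hcop with hβ
  have hβa : (β : ZMod ℓ) = (a : ZMod ℓ) := by rw [hβ, ZMod.coe_unitOfCoprime]
  obtain ⟨n, hn⟩ := three_dvd_latticeCoord_shift' hK D hopt hadd hirr h3c h9 hℓ hℓN h12 hL hy hodd β
  refine ⟨n, ?_⟩
  -- rewrite both classes through `y`
  have h3a : modularSymbol D.f (((3 * a : ℕ) : ℚ) / ℓ) =
      modularSymbol D.f (((((3 * a : ℕ) : ZMod ℓ).val : ℕ) : ℚ) / ℓ) := by
    have := modularSymbol_div_eq_of_intCast D.f hℓ.ne_zero ((3 * a : ℕ) : ℤ)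
    rw [Int.cast_natCast] at this
    rw [this]; push_cast; ring_nf
  have h1a : modularSymbol D.f ((a : ℚ) / ℓ) =
      modularSymbol D.f (((((a : ℕ) : ZMod ℓ).val : ℕ) : ℚ) / ℓ) := by
    have := modularSymbol_div_eq_of_intCast D.f hℓ.ne_zero ((a : ℕ) : ℤ)
    rw [Int.cast_natCast] at this
    rw [this]; push_cast; ring_nf
  rw [h3a, h1a, Complex.sub_im, hy, hy]
  have e3 : ((3 * a : ℕ) : ZMod ℓ) = 3 * (β : ZMod ℓ) := by rw [hβa]; push_cast; ring
  have e1 : ((a : ℕ) : ZMod ℓ) = (β : ZMod ℓ) := hβa.symm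
  rw [e3, e1]
  have : ((y (3 * (β : ZMod ℓ)) : ℝ)) - (y (β : ZMod ℓ) : ℝ) = 3 * (n : ℝ) := by
    have := congrArg (fun z : ℤ ↦ (z : ℝ)) hn
    push_cast at this
    linarith
  calc (y (3 * (β : ZMod ℓ)) : ℝ) * (minusPeriod D.f / 2) - (y (β : ZMod ℓ) : ℝ) * (minusPeriod D.f / 2)
      = (((y (3 * (β : ZMod ℓ)) : ℝ)) - (y (β : ZMod ℓ) : ℝ)) * (minusPeriod D.f / 2) := by ring
    _ = 3 * n * (minusPeriod D.f / 2) := by rw [this]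


/-- **The shift step from the fact alone** — VERBATIM the hypothesis `hE` of the tree's
`katoShiftTwistManinThree_of_shiftStep` (= the conclusion of the line's registered stub
`stub_three_dvd_shiftClass`, vocabulary `AdmissiblePrime` / `shiftClass` of `KatoShiftThreeLawsEdges`).
[cite: Kato2004Asterisque, Thm. 9.7 (p. 189)] [cite: KostersPannekoek2017, Thm. 1 (ii)] -/
theorem shiftStep_of_katoFact (hK : kato_neron_isIntegral_twistedSymbolSum_of_additive_three_polar) :
    ∀ (W : WeierstrassCurve ℚ) [W.IsElliptic] [W.IsGloballyMinimal] {N : ℕ} [NeZero N]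
      (D : ModularParametrizationData W N),
      (∀ z ∈ D.L.lattice, ∃ w ∈ periodLattice D.f, z = D.c * w) → 3 ^ 2 ∣ N →
      ¬ W.HasGoodReductionAtPrime 3 → ¬ W.HasMultiplicativeReductionAtPrime 3 →
      W.HasIrreducibleModPGaloisRep 3 → (3 : ℤ) ∣ D.c →
      ∀ ℓ : ℕ, AdmissiblePrime W N ℓ → ∀ a : ℕ, 0 < a → a < ℓ →
        ∃ n : ℤ, (shiftClass D.f ℓ a).im = 3 * n * (minusPeriod D.f / 2) := by
  intro W _ _ N _ D hopt h9 hg hm hirr h3c ℓ hadm a ha0 haℓ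
  obtain ⟨hℓ, hℓN, h12, hL⟩ := hadm
  have hL' : ∀ q ∈ N.primeFactors, ¬ q ^ 2 ∣ N →
      jacobiSym (q : ℤ) ℓ = (if ((q : ℤ) * W.LFunction q) % 3 = 1 then -1 else 1) :=
    fun q hq hq2 ↦ by rw [hL q hq hq2]; rfl
  exact exists_int_im_shiftClass_eq_three_mul' hK D hopt h9 ⟨hg, hm⟩ hirr h3c hℓ hℓN h12 hL' a ha0 haℓ

/-- **E-es-18 `KatoShiftTwistManinThree` ⟸ the `p = 3` Kato fact ∧ the shift-generation law E-es-19**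
(the tree's lever `katoShiftTwistManinThree_of_shiftStep` with its remaining stub discharged).
[cite: Kato2004Asterisque, Thm. 9.7 (p. 189)] -/
theorem katoShiftTwistManinThree_of_katoFact_of_generation
    (hK : kato_neron_isIntegral_twistedSymbolSum_of_additive_three_polar)
    (hG : ShiftClassGenerationThree) : KatoShiftTwistManinThree :=
  katoShiftTwistManinThree_of_shiftStep (shiftStep_of_katoFact hK) hG

/-- **The crux C3 BY NAME, conditionally**: `ManinPrimeToThreeAtNine` (stmt-BirchSwinnertonDyer-22968)
follows from the `p = 3` Kato fact (tree named fact, statement only), the shift-generation law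
`ShiftClassGenerationThree` (`@[conjecture]` leaf E-es-19) and the reducible residual
`ManinPrimeToThreeOfReducible` (`@[conjecture]` leaf) — and from nothing else. A `proof.conditional`,
not a closure: two of the three inputs are open. [cite: Kato2004Asterisque, Thm. 9.7 (p. 189)] -/
theorem maninPrimeToThreeAtNine_of_katoFact_of_generation_of_reducible
    (hK : kato_neron_isIntegral_twistedSymbolSum_of_additive_three_polar)
    (hG : ShiftClassGenerationThree) (hB : ManinPrimeToThreeOfReducible) :
    Summit.BirchSwinnertonDyer.BirchSwinnertonDyer.Theses.ManinLocalTwoThree.ManinPrimeToThreeAtNine :=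
  maninPrimeToThreeAtNine_of_katoShift_of_reducible (katoShiftTwistManinThree_of_katoFact_of_generation hK hG) hB

end Assembly

end Summit.BirchSwinnertonDyer.BirchSwinnertonDyer.Theorems.ManinLocalTwoThree

end
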